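import Summits.QuantumAdvantage.QuantumAdvantage.Theses.ArithStatLadder
import Summits.QuantumAdvantage.QuantumAdvantage.Theorems.ArithStatLadderIqThreeNotPPoly
import Summits.QuantumAdvantage.QuantumAdvantage.Theorems.ArithStatLadderIqThreeNotPPolyStubSamplerNG
import Summits.QuantumAdvantage.QuantumAdvantage.Theorems.ArithStatLadderIqThreeNotPPolyStubOneSidedNG
import Summits.QuantumAdvantage.QuantumAdvantage.Theorems.ArithStatLadderIqThreeNotPPolyStubFundDensityNG
import Summits.QuantumAdvantage.QuantumAdvantage.Theorems.ArithStatLadderIqThreeNotPPolyStubNagellHit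
import Summits.QuantumAdvantage.QuantumAdvantage.Theorems.ArithStatLadderIqThreeNotPPolyBPPRurClosure
import Literature.Computability.Cryptography.HallgrenClassGroup
import Literature.Computability.Complexity.StackWords

/-!
# Crux `ArithStatLadder.IqThreeNotPPoly` (stmt-QuantumAdvantage-2422): the UNIFORM refutation floor

Line `Sketch` (skeleton v4, gen-1 lead), uniform companion of `ArithStatLadderIqThreeNotPPolyNagell.lean`.
The same one-sided randomized reduction `SQUAREFREES ≤ IQ3` (Nagell sampler `stub_samplerNG` with the
numeral guard `stub_natAdapter`, exact NO side `stub_oneSidedNG`, YES-density `≥ 1/4`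
`stub_fundDensityNG`, hits certified CFT-free by Nagell's elementary 3-torsion `stub_nagellHit`),
fed to the closure of `BPP` under such reductions (`mem_BPP_of_rurReduction`), gives:

* `sqfree_mem_BPP_of_iqThree_mem_BPP` — **`IQ3 ∈ BPP → SQUAREFREES ∈ BPP`** (unconditional);
* `sqfree_mem_BPP_of_not_iqThreeNotBPP` — the floor under every refutation of the route's BINDER
  `IqThreeNotBPP` (kill criterion (i) of the thesis: a `BPP` algorithm for `h(−d) mod 3` on
  fundamental discriminants gives a `BPP` squarefreeness test — Adleman–McCurley open problem O8);
* `iqThreeNotBPP_of_sqfreeNotBPP` — **the binder `IqThreeNotBPP` from the UNIFORM apex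
  "SQUAREFREES ∉ BPP"** (a hypothesis weaker than the non-uniform apex of `IqThreeNotPPoly`;
  CONDITIONAL theorem about the route decl `IqThreeNotBPP`, by name).
Theorems only; sorry-free.
-/

set_option linter.dupNamespace false -- D-0017: single-problem summit ⇒ `QuantumAdvantage.QuantumAdvantage` by design

noncomputable section

namespace Summit.QuantumAdvantage.QuantumAdvantage.Theorems.IqThreeNotPPoly

open scoped Classical
open _root_.Computability Polynomial Literature.Computability.Complexity
open Literature.Computability.Cryptography (IsNegFundamentalDiscr)
open Literature.NumberTheory.QuadraticFields (BinaryQuadraticForm.classNumber)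
open Summit.QuantumAdvantage.QuantumAdvantage.Theses.ArithStatLadder (IqThreeNotBPP)

/-- **`IQ3 ∈ BPP → SQUAREFREES ∈ BPP`, unconditionally.** The Nagell reduction of line `Sketch`
v4 (`stub_samplerNG`, `stub_natAdapter`, `stub_oneSidedNG`, `stub_fundDensityNG`,
`stub_nagellHit`) fed to `mem_BPP_of_rurReduction` with seed polynomial `8 X + 48`.
[cite: Nagell1922, §1] -/
theorem sqfree_mem_BPP_of_iqThree_mem_BPP
    (hIQ : encodingNatBool.toLanguage
      {d : ℕ | IsNegFundamentalDiscr d ∧ 3 ∣ BinaryQuadraticForm.classNumber (-(d : ℤ))} ∈ BPP) :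
    encodingNatBool.toLanguage {m : ℕ | Squarefree m} ∈ BPP := by
  obtain ⟨f, hf, hfval⟩ := stub_samplerNG
  obtain ⟨f', hf', hcanon, hjunk⟩ := stub_natAdapter f hf []
  obtain ⟨n₀, hdens⟩ := stub_fundDensityNG
  refine mem_BPP_of_rurReduction (encodingNatBool.toLanguage {m : ℕ | Squarefree m})
    (encodingNatBool.toLanguage
      {d : ℕ | IsNegFundamentalDiscr d ∧ 3 ∣ BinaryQuadraticForm.classNumber (-(d : ℤ))})
    f' hf' (8 * X + 48) n₀ ?_ ?_ hIQ
  · -- NO side (exact): non-squarefree numerals by `stub_oneSidedNG`, non-numerals by the guard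
    intro x hx r
    by_cases hcx : ∃ m : ℕ, encodeNat m = x
    · obtain ⟨m, rfl⟩ := hcx
      have hm : ¬ Squarefree m := fun h =>
        hx ((encodeNat_mem_toLanguage_iff {m : ℕ | Squarefree m} m).2 h)
      rw [hcanon, hfval, bitsToNat_encodeNat, encodeNat_mem_toLanguage_iff]
      rintro ⟨hfund, -⟩
      exact stub_oneSidedNG m (bitsToNat r) hm hfund
    · rw [hjunk x r (fun m hm => hcx ⟨m, hm⟩)]
      exact nil_not_mem_iqThreeLanguage
  · -- YES side (density ≥ 1/4), and fundamental seeds are in `S`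
    intro x hx hn
    obtain ⟨N, hN, hNx⟩ := hx
    change encodeNat N = x at hNx
    subst hNx
    have hsq : Squarefree N := hN
    have h := hdens (encodeNat N).length hn N hsq rfl
    generalize hE : (8 * X + 48 : Polynomial ℕ).eval (encodeNat N).length = E
    have hE' : E = 8 * (encodeNat N).length + 48 := by
      rw [← hE]; simp only [eval_add, eval_mul, eval_ofNat, eval_X]
    subst hE'
    refine h.trans (Nat.mul_le_mul_left _ ?_)
    rw [← card_filter_seeds (8 * (encodeNat N).length + 48) (fun k =>
      IsNegFundamentalDiscr (N * (1 + 6 * (1 + 2 ^ 30 * N ^ 5) * N * k) *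
        (4 * (1 + 2 ^ 30 * N ^ 5) ^ 3 - N * (1 + 6 * (1 + 2 ^ 30 * N ^ 5) * N * k))))]
    refine Finset.card_le_card fun r hr => ?_
    rw [Finset.mem_filter] at hr ⊢
    refine ⟨Finset.mem_univ _, ?_⟩
    rw [hcanon, hfval, bitsToNat_encodeNat, encodeNat_mem_toLanguage_iff]
    exact ⟨hr.2, stub_nagellHit N _ hr.2⟩

/-- **The uniform refutation floor**: a refutation of the route's binder `IqThreeNotBPP` (a `BPP`
algorithm for `3 ∣ h(−d)` on fundamental discriminants) yields a `BPP` squarefreeness test.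
[cite: Nagell1922, §1] -/
theorem sqfree_mem_BPP_of_not_iqThreeNotBPP (h : ¬ IqThreeNotBPP) :
    encodingNatBool.toLanguage {m : ℕ | Squarefree m} ∈ BPP :=
  sqfree_mem_BPP_of_iqThree_mem_BPP (not_not.1 h)

/-- **The binder from the uniform apex: `SQUAREFREES ∉ BPP → IqThreeNotBPP`** (CONDITIONAL theorem
about the route decl, by name; the hypothesis "squarefreeness is not decidable in probabilistic
polynomial time" is hypothesis-type, Adleman–McCurley O8, and is WEAKER than the non-uniform apex
`SQUAREFREES ∉ P/poly` of the crux `IqThreeNotPPoly`). [cite: Nagell1922, §1] -/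
theorem iqThreeNotBPP_of_sqfreeNotBPP :
    encodingNatBool.toLanguage {m : ℕ | Squarefree m} ∉ BPP → IqThreeNotBPP :=
  fun hX hIQ => hX (sqfree_mem_BPP_of_iqThree_mem_BPP hIQ)

end Summit.QuantumAdvantage.QuantumAdvantage.Theorems.IqThreeNotPPoly

end
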